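import Mathlib
import Literature.RingTheory.MvPowerSeries.OptionEquivLeft
import Summits.ValiantsHypothesis.ValiantsHypothesis.Theorems.BinomialElusiveBinomialCandidateShallowCorankOne
import Summits.ValiantsHypothesis.ValiantsHypothesis.Theorems.BinomialElusiveBinomialCandidateCorankTwoSquares
import Summits.ValiantsHypothesis.ValiantsHypothesis.Theorems.BinomialElusiveBinomialCandidateCorankTwoKernelPlane
import Summits.ValiantsHypothesis.ValiantsHypothesis.Theorems.BinomialElusiveBinomialCandidateCorankTwoWeightedNorm

/-!
# Crux `BinomialElusive.BinomialCandidate` (stmt-ValiantsHypothesis-7392), line `registered`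
# (skeleton v6) — stub `stub_nondegenerateCorankTwo`, assembly helpers (part 1)

Helpers for the assembly of the nondegenerate corank-two package (the registered stub
`stub_nondegenerateCorankTwo`):

* `nondegenerateCorankTwo_adaptedBasis` (registered helper) — the linear-algebra repackaging of
  step 2 of the assembly: given a kernel basis `κ₁, κ₂`, three independent left-kernel functionals
  `λ_a` and the nondegeneracy of the three binary quadratic forms `x ↦ λ_a · Q(x₁κ₁ + x₂κ₂)`,
  the pieces `binaryQuadratic_squares` (A) and the plane expansion of
  `kernelPlane_coefficients` (B2) give a new kernel basis `κ'₁, κ'₂` and new functionals `λ'_a`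
  (same span) for which `λ'_0 · Q` restricted to the kernel plane is `y²` and `λ'_1 · Q` is `x²`
  (six coefficient identities);
* `NondegenerateCorankTwo.exists_axisHom` — the axis homomorphism `ℂ⟦(X_t)_t⟧ → ℂ⟦x⟧` keeping
  one variable, for an arbitrary index type (cf. `CorankOneLeadingForm.exists_axisHom`);
* `NondegenerateCorankTwo.axis_det_order_four` — piece (G) `weightedNorm_order_four` transported
  along the axis homomorphism: the `X₁`-axis coefficients of the level-1 eliminant `det M_v`;
* `NondegenerateCorankTwo.coeff_aeval_plane` — substituting the kernel-surface jet
  `(X_0, X_1, φ)`, `φ = O(2)`, into a polynomial without monomials of degree `< 2` does not change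
  the coefficients of degree `2` in `X_0, X_1` (`JetReduction.aeval_sub_aeval_degGE` and the
  restriction `MvPolynomial.killCompl`);
* two transport lemmas (`constantCoeff_coeff_optionEquivLeft`, `coe_add_C_X`) used by the
  two-level elimination.
-/

-- layout Summits/ValiantsHypothesis/ValiantsHypothesis forces the duplicated namespace component
set_option linter.dupNamespace false

noncomputable section

namespace Summit.ValiantsHypothesis.ValiantsHypothesis.Theorems.BinomialCandidateStubs

open scoped BigOperators
open MvPolynomial

namespace NondegenerateCorankTwo

/-! ## Binary quadratic forms on the kernel plane -/

/-- A row `l` applied to quadratic forms `Q_i`, on the plane spanned by `κ₁, κ₂`. -/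
theorem sum_mul_eval_plane {k m : ℕ} {Q : Fin m → MvPolynomial (Fin k) ℂ}
    (hQ : ∀ i, (Q i).IsHomogeneous 2) (l : Fin m → ℂ) (κ₁ κ₂ : Fin k → ℂ) (x y : ℂ) :
    ∑ i, l i * eval (x • κ₁ + y • κ₂) (Q i) =
      x ^ 2 * (∑ i, l i * eval κ₁ (Q i)) +
        x * y * (∑ i, l i * ∑ j, κ₂ j * eval κ₁ (pderiv j (Q i))) +
        y ^ 2 * (∑ i, l i * eval κ₂ (Q i)) := by
  rw [Finset.mul_sum, Finset.mul_sum, Finset.mul_sum, ← Finset.sum_add_distrib,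
    ← Finset.sum_add_distrib]
  refine Finset.sum_congr rfl fun i _ => ?_
  rw [CorankTwoKernelPlane.eval_plane_of_isHomogeneous_two (hQ i)]
  ring

/-- Reading off the three coefficients of an identity of binary quadratic polynomials. -/
theorem quadCoeff_eq {A B C A' B' C' : ℂ}
    (h : ∀ x y : ℂ, x ^ 2 * A + x * y * B + y ^ 2 * C = x ^ 2 * A' + x * y * B' + y ^ 2 * C') :
    A = A' ∧ B = B' ∧ C = C' := by
  have h1 := h 1 0
  have h2 := h 0 1
  have h3 := h 1 1
  norm_num at h1 h2 h3
  exact ⟨h1, by linear_combination h3 - h1 - h2, h2⟩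

/-- The four entries of a product of `2 × 2` matrices equal to `1`. -/
theorem two_mul_entries {τ τ' : Matrix (Fin 2) (Fin 2) ℂ} (h : τ * τ' = 1) :
    τ 0 0 * τ' 0 0 + τ 0 1 * τ' 1 0 = 1 ∧ τ 0 0 * τ' 0 1 + τ 0 1 * τ' 1 1 = 0 ∧
      τ 1 0 * τ' 0 0 + τ 1 1 * τ' 1 0 = 0 ∧ τ 1 0 * τ' 0 1 + τ 1 1 * τ' 1 1 = 1 := by
  have e := fun i j => congr_fun (congr_fun h i) j
  simp only [Matrix.mul_apply, Fin.sum_univ_two] at e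
  refine ⟨?_, ?_, ?_, ?_⟩
  · rw [e, Matrix.one_apply_eq]
  · rw [e, Matrix.one_apply_ne (by decide)]
  · rw [e, Matrix.one_apply_ne (by decide)]
  · rw [e, Matrix.one_apply_eq]

end NondegenerateCorankTwo

open NondegenerateCorankTwo in
/-- **Adapted kernel basis and functionals** (registered helper of the stub
`stub_nondegenerateCorankTwo`, step 2 of the assembly).  For quadratic forms `Q_i`, a matrix
`J`, a basis `κ₁, κ₂` of the kernel of `J`, three independent functionals `λ_a` in the left
kernel of `J` such that the three binary quadratic forms `(x₁, x₂) ↦ Σ_i λ_a i Q_i(x₁κ₁ + x₂κ₂)`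
have no common nontrivial zero, there are a new kernel basis `κ'₁, κ'₂` (same span) and new
independent left-kernel functionals `λ'_a` with `Σ_i λ'_0 i Q_i(xκ'₁ + yκ'₂) = y²` and
`Σ_i λ'_1 i Q_i(xκ'₁ + yκ'₂) = x²`, stated through the six coefficients. -/
theorem nondegenerateCorankTwo_adaptedBasis :
    ∀ (k m : ℕ) (Q : Fin m → MvPolynomial (Fin k) ℂ) (J : Fin m → Fin k → ℂ)
      (κ₁ κ₂ : Fin k → ℂ) (lam : Fin 3 → Fin m → ℂ),
      (∀ i, (Q i).IsHomogeneous 2) →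
      (∀ i, ∑ j, κ₁ j * J i j = 0) → (∀ i, ∑ j, κ₂ j * J i j = 0) →
      (∀ c₁ c₂ : ℂ, c₁ • κ₁ + c₂ • κ₂ = 0 → c₁ = 0 ∧ c₂ = 0) →
      (∀ κ' : Fin k → ℂ, (∀ i, ∑ j, κ' j * J i j = 0) → ∃ μ₁ μ₂ : ℂ, κ' = μ₁ • κ₁ + μ₂ • κ₂) →
      (∀ a : Fin 3, ∀ j : Fin k, ∑ i, lam a i * J i j = 0) →
      (∀ c : Fin 3 → ℂ, (∀ i, ∑ a, c a * lam a i = 0) → c = 0) →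
      (∀ x₁ x₂ : ℂ, (∀ a : Fin 3, ∑ i, lam a i * MvPolynomial.eval (x₁ • κ₁ + x₂ • κ₂) (Q i) = 0) →
        x₁ = 0 ∧ x₂ = 0) →
      ∃ (κ₁' κ₂' : Fin k → ℂ) (lam' : Fin 3 → Fin m → ℂ),
        (∀ i, ∑ j, κ₁' j * J i j = 0) ∧ (∀ i, ∑ j, κ₂' j * J i j = 0) ∧
        (∀ c₁ c₂ : ℂ, c₁ • κ₁' + c₂ • κ₂' = 0 → c₁ = 0 ∧ c₂ = 0) ∧
        (∀ κ' : Fin k → ℂ, (∀ i, ∑ j, κ' j * J i j = 0) → ∃ μ₁ μ₂ : ℂ, κ' = μ₁ • κ₁' + μ₂ • κ₂') ∧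
        (∀ a : Fin 3, ∀ j : Fin k, ∑ i, lam' a i * J i j = 0) ∧
        (∀ c : Fin 3 → ℂ, (∀ i, ∑ a, c a * lam' a i = 0) → c = 0) ∧
        ∑ i, lam' 0 i * MvPolynomial.eval κ₁' (Q i) = 0 ∧
        ∑ i, lam' 0 i * (∑ j, κ₂' j * MvPolynomial.eval κ₁' (MvPolynomial.pderiv j (Q i))) = 0 ∧
        ∑ i, lam' 0 i * MvPolynomial.eval κ₂' (Q i) = 1 ∧
        ∑ i, lam' 1 i * MvPolynomial.eval κ₁' (Q i) = 1 ∧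
        ∑ i, lam' 1 i * (∑ j, κ₂' j * MvPolynomial.eval κ₁' (MvPolynomial.pderiv j (Q i))) = 0 ∧
        ∑ i, lam' 1 i * MvPolynomial.eval κ₂' (Q i) = 0 := by
  intro k m Q J κ₁ κ₂ lam hQ hker₁ hker₂ hκ hcorank hlamJ hlam hnd
  -- the three binary quadratic forms `c a`
  obtain ⟨c, hc⟩ : ∃ c : Fin 3 → Fin 3 → ℂ, ∀ a, c a 0 = ∑ i, lam a i * eval κ₁ (Q i) ∧
      c a 1 = ∑ i, lam a i * ∑ j, κ₂ j * eval κ₁ (pderiv j (Q i)) ∧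
      c a 2 = ∑ i, lam a i * eval κ₂ (Q i) :=
    ⟨fun a => ![∑ i, lam a i * eval κ₁ (Q i), ∑ i, lam a i * ∑ j, κ₂ j * eval κ₁ (pderiv j (Q i)),
      ∑ i, lam a i * eval κ₂ (Q i)], fun a => ⟨rfl, rfl, rfl⟩⟩
  have key : ∀ (l : Fin m → ℂ) (x y : ℂ), ∑ i, l i * eval (x • κ₁ + y • κ₂) (Q i) =
      (∑ i, l i * eval κ₁ (Q i)) * x ^ 2 +
        (∑ i, l i * ∑ j, κ₂ j * eval κ₁ (pderiv j (Q i))) * x * y +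
        (∑ i, l i * eval κ₂ (Q i)) * y ^ 2 := fun l x y => by
    rw [sum_mul_eval_plane hQ]; ring
  have keyc : ∀ a x y, ∑ i, lam a i * eval (x • κ₁ + y • κ₂) (Q i) =
      c a 0 * x ^ 2 + c a 1 * x * y + c a 2 * y ^ 2 := fun a x y => by
    rw [key, (hc a).1, (hc a).2.1, (hc a).2.2]
  have bpf : ∀ x y : ℂ, (∀ a, c a 0 * x ^ 2 + c a 1 * x * y + c a 2 * y ^ 2 = 0) → x = 0 ∧ y = 0 :=
    fun x y h => hnd x y fun a => by rw [keyc]; exact h a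
  obtain ⟨Λ, Λ', σ, σ', hΛΛ', _hΛ'Λ, hσσ', hσ'σ, hy2, hx2⟩ := binaryQuadratic_squares c bpf
  -- the new data
  set κ₁n : Fin k → ℂ := σ 0 0 • κ₁ + σ 1 0 • κ₂ with hκ₁n
  set κ₂n : Fin k → ℂ := σ 0 1 • κ₁ + σ 1 1 • κ₂ with hκ₂n
  have combo : ∀ x y : ℂ, x • κ₁n + y • κ₂n =
      (σ 0 0 * x + σ 0 1 * y) • κ₁ + (σ 1 0 * x + σ 1 1 * y) • κ₂ := fun x y => by
    funext j
    simp only [hκ₁n, hκ₂n, Pi.add_apply, Pi.smul_apply, smul_eq_mul]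
    ring
  have kerlin : ∀ (s t : ℂ) (i : Fin m), ∑ j, (s • κ₁ + t • κ₂) j * J i j = 0 := by
    intro s t i
    simp only [Pi.add_apply, Pi.smul_apply, smul_eq_mul, add_mul, mul_assoc,
      Finset.sum_add_distrib, ← Finset.mul_sum, hker₁ i, hker₂ i, mul_zero, add_zero]
  -- the transformed forms
  have trans : ∀ (a : Fin 3) (x y : ℂ),
      ∑ i, (∑ b, Λ a b * lam b i) * eval (x • κ₁n + y • κ₂n) (Q i) =
        ∑ b, Λ a b * (c b 0 * (σ 0 0 * x + σ 0 1 * y) ^ 2 +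
          c b 1 * (σ 0 0 * x + σ 0 1 * y) * (σ 1 0 * x + σ 1 1 * y) +
          c b 2 * (σ 1 0 * x + σ 1 1 * y) ^ 2) := by
    intro a x y
    simp only [← keyc]
    simp only [combo, Finset.mul_sum, Finset.sum_mul, mul_assoc]
    exact Finset.sum_comm
  have T0 : ∀ x y : ℂ, x ^ 2 * (∑ i, (∑ b, Λ 0 b * lam b i) * eval κ₁n (Q i)) +
      x * y * (∑ i, (∑ b, Λ 0 b * lam b i) * ∑ j, κ₂n j * eval κ₁n (pderiv j (Q i))) +
      y ^ 2 * (∑ i, (∑ b, Λ 0 b * lam b i) * eval κ₂n (Q i)) =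
      x ^ 2 * 0 + x * y * 0 + y ^ 2 * 1 := fun x y => by
    rw [← sum_mul_eval_plane hQ, trans, hy2]; ring
  have T1 : ∀ x y : ℂ, x ^ 2 * (∑ i, (∑ b, Λ 1 b * lam b i) * eval κ₁n (Q i)) +
      x * y * (∑ i, (∑ b, Λ 1 b * lam b i) * ∑ j, κ₂n j * eval κ₁n (pderiv j (Q i))) +
      y ^ 2 * (∑ i, (∑ b, Λ 1 b * lam b i) * eval κ₂n (Q i)) =
      x ^ 2 * 1 + x * y * 0 + y ^ 2 * 0 := fun x y => by
    rw [← sum_mul_eval_plane hQ, trans, hx2]; ring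
  obtain ⟨n00, n01, n02⟩ := quadCoeff_eq T0
  obtain ⟨n10, n11, n12⟩ := quadCoeff_eq T1
  obtain ⟨e00, e01, e10, e11⟩ := two_mul_entries hσ'σ
  obtain ⟨f00, f01, f10, f11⟩ := two_mul_entries hσσ'
  refine ⟨κ₁n, κ₂n, fun a i => ∑ b, Λ a b * lam b i, fun i => kerlin _ _ i, fun i => kerlin _ _ i,
    ?_, ?_, ?_, ?_, n00, n01, n02, n10, n11, n12⟩
  · -- independence of the new kernel basis
    intro c₁ c₂ h
    rw [combo] at h
    obtain ⟨h1, h2⟩ := hκ _ _ h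
    constructor
    · linear_combination σ' 0 0 * h1 + σ' 0 1 * h2 - c₁ * e00 - c₂ * e01
    · linear_combination σ' 1 0 * h1 + σ' 1 1 * h2 - c₁ * e10 - c₂ * e11
  · -- the new basis spans the kernel
    intro κ' hκ'
    obtain ⟨ν₁, ν₂, hν⟩ := hcorank κ' hκ'
    refine ⟨σ' 0 0 * ν₁ + σ' 0 1 * ν₂, σ' 1 0 * ν₁ + σ' 1 1 * ν₂, ?_⟩
    funext j
    have hνj := congr_fun hν j
    simp only [hκ₁n, hκ₂n, Pi.add_apply, Pi.smul_apply, smul_eq_mul] at hνj ⊢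
    linear_combination hνj - κ₁ j * ν₁ * f00 - κ₁ j * ν₂ * f01 - κ₂ j * ν₁ * f10 -
      κ₂ j * ν₂ * f11
  · -- the new functionals kill the image
    intro a j
    calc ∑ i, (∑ b, Λ a b * lam b i) * J i j = ∑ b, Λ a b * ∑ i, lam b i * J i j := by
          simp only [Finset.sum_mul, Finset.mul_sum, mul_assoc]; exact Finset.sum_comm
      _ = 0 := Finset.sum_eq_zero fun b _ => by rw [hlamJ b j, mul_zero]
  · -- independence of the new functionals
    intro d hd
    have h1 : Matrix.vecMul d Λ = 0 := by
      refine hlam _ fun i => ?_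
      calc ∑ a, Matrix.vecMul d Λ a * lam a i = ∑ a, (∑ b, d b * Λ b a) * lam a i := rfl
        _ = ∑ b, d b * ∑ a, Λ b a * lam a i := by
            simp only [Finset.sum_mul, Finset.mul_sum, mul_assoc]; exact Finset.sum_comm
        _ = 0 := hd i
    calc d = Matrix.vecMul d (Λ * Λ') := by rw [hΛΛ', Matrix.vecMul_one]
      _ = 0 := by rw [← Matrix.vecMul_vecMul, h1, Matrix.zero_vecMul]

namespace NondegenerateCorankTwo

/-! ## The axis homomorphism and the level-1 eliminant on the `X₁`-axis -/

/-- The restriction `ρ_s : ℂ⟦(X_t)_t⟧ → ℂ⟦x⟧` to the `X_s`-axis, `ρ_s f = Σ_n coeff_{X_s^n}(f) xⁿ`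
(all other variables set to `0`), as a ring homomorphism (arbitrary index type). -/
theorem exists_axisHom {τ : Type*} (s : τ) :
    ∃ ρ : MvPowerSeries τ ℂ →+* PowerSeries ℂ,
      ∀ f n, PowerSeries.coeff n (ρ f) = MvPowerSeries.coeff (Finsupp.single s n) f := by
  classical
  let ρ : MvPowerSeries τ ℂ →+* PowerSeries ℂ :=
    { toFun := fun f => PowerSeries.mk fun n => MvPowerSeries.coeff (Finsupp.single s n) f
      map_one' := by
        refine PowerSeries.ext fun n => ?_
        simp only [PowerSeries.coeff_mk, MvPowerSeries.coeff_one, PowerSeries.coeff_one,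
          Finsupp.single_eq_zero]
      map_mul' := by
        intro f g
        refine PowerSeries.ext fun n => ?_
        simp only [PowerSeries.coeff_mk, MvPowerSeries.coeff_mul, Finsupp.antidiagonal_single,
          Finset.sum_map, Function.Embedding.coe_prodMap, Function.Embedding.coeFn_mk,
          Prod.map_fst, Prod.map_snd, PowerSeries.coeff_mul]
      map_zero' := PowerSeries.ext fun n => by simp
      map_add' := fun f g => PowerSeries.ext fun n => by simp }
  refine ⟨ρ, fun f n => ?_⟩
  show PowerSeries.coeff n (PowerSeries.mk fun n => MvPowerSeries.coeff (Finsupp.single s n) f) = _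
  exact PowerSeries.coeff_mk _ _

/-- **Piece (G) on the `X_s`-axis.**  If `Fu = X₂² + (weight ≥ 3)` and `Fv = X₁² + (weight ≥ 3)`
on the `X_s`-axis (`X₁ := X_s`; the displayed coefficients of weight `≤ 2`), then the remainder
matrix `M` of the divisions of `X₂^j Fv` by `Fu` has `det M = X₁⁴ + O(X₁⁵)` on the axis. -/
theorem axis_det_order_four {τ : Type*} (s : τ) (Fu Fv : PowerSeries (MvPowerSeries τ ℂ))
    (M : Matrix (Fin 2) (Fin 2) (MvPowerSeries τ ℂ)) (Q : Fin 2 → PowerSeries (MvPowerSeries τ ℂ))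
    (hu : ∀ i j : ℕ, i + j ≤ 1 →
      MvPowerSeries.coeff (Finsupp.single s i) (PowerSeries.coeff j Fu) = 0)
    (hu02 : MvPowerSeries.coeff (Finsupp.single s 0) (PowerSeries.coeff 2 Fu) = 1)
    (hu11 : MvPowerSeries.coeff (Finsupp.single s 1) (PowerSeries.coeff 1 Fu) = 0)
    (hu20 : MvPowerSeries.coeff (Finsupp.single s 2) (PowerSeries.coeff 0 Fu) = 0)
    (hv : ∀ i j : ℕ, i + j ≤ 1 →
      MvPowerSeries.coeff (Finsupp.single s i) (PowerSeries.coeff j Fv) = 0)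
    (hv02 : MvPowerSeries.coeff (Finsupp.single s 0) (PowerSeries.coeff 2 Fv) = 0)
    (hv11 : MvPowerSeries.coeff (Finsupp.single s 1) (PowerSeries.coeff 1 Fv) = 0)
    (hv20 : MvPowerSeries.coeff (Finsupp.single s 2) (PowerSeries.coeff 0 Fv) = 1)
    (hdiv : ∀ j : Fin 2, PowerSeries.X ^ (j : ℕ) * Fv =
      Q j * Fu + ∑ l : Fin 2, PowerSeries.C (M l j) * PowerSeries.X ^ (l : ℕ)) :
    (∀ n < 4, MvPowerSeries.coeff (Finsupp.single s n) M.det = 0) ∧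
      MvPowerSeries.coeff (Finsupp.single s 4) M.det = 1 := by
  obtain ⟨ρ, hρ⟩ := exists_axisHom s
  have hc : ∀ (F : PowerSeries (MvPowerSeries τ ℂ)) (i j : ℕ),
      PowerSeries.coeff i (PowerSeries.coeff j (PowerSeries.map ρ F)) =
        MvPowerSeries.coeff (Finsupp.single s i) (PowerSeries.coeff j F) := fun F i j => by
    rw [PowerSeries.coeff_map, hρ]
  have h0 := congrArg (PowerSeries.map ρ) (hdiv 0)
  have h1 := congrArg (PowerSeries.map ρ) (hdiv 1)
  simp only [Fin.val_zero, Fin.val_one, pow_zero, pow_one, one_mul, mul_one, map_mul, map_add,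
    PowerSeries.map_C, PowerSeries.map_X, Fin.sum_univ_two] at h0 h1
  obtain ⟨hlt, h4⟩ := weightedNorm_order_four (PowerSeries.map ρ Fu) (PowerSeries.map ρ Fv)
    (PowerSeries.map ρ (Q 0)) (PowerSeries.map ρ (Q 1)) (ρ (M 0 0)) (ρ (M 1 0)) (ρ (M 0 1))
    (ρ (M 1 1)) (fun i j hij => by rw [hc]; exact hu i j hij) (by rw [hc]; exact hu02)
    (by rw [hc]; exact hu11) (by rw [hc]; exact hu20) (fun i j hij => by rw [hc]; exact hv i j hij)
    (by rw [hc]; exact hv02) (by rw [hc]; exact hv11) (by rw [hc]; exact hv20) h0 h1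
  have hdet : ρ M.det = ρ (M 0 0) * ρ (M 1 1) - ρ (M 1 0) * ρ (M 0 1) := by
    rw [Matrix.det_fin_two, map_sub, map_mul, map_mul]; ring
  refine ⟨fun n hn => ?_, ?_⟩
  · rw [← hρ, hdet]; exact hlt n hn
  · rw [← hρ, hdet]; exact h4

/-! ## Substituting the kernel-surface jet -/

/-- Substituting the jet `(X_0, X_1, φ)` with `φ = O(degree 2)` into a polynomial `H` without
monomials of degree `< 2` does not change the coefficients of degree `≤ 2` in `X_0, X_1`. -/
theorem coeff_aeval_plane {n₀ : ℕ} (φ : Fin n₀ → MvPolynomial (Fin 2) ℂ)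
    (hφ : ∀ j', ∀ e : Fin 2 →₀ ℕ, e.degree < 2 → coeff e (φ j') = 0)
    (H : MvPolynomial (Fin (n₀ + 2)) ℂ) (hH : ∀ d : Fin (n₀ + 2) →₀ ℕ, d.degree < 2 → coeff d H = 0)
    (i j : ℕ) (hij : i + j < 3) :
    coeff (Finsupp.single 0 i + Finsupp.single 1 j)
        (aeval (Fin.cons (X 0) (Fin.cons (X 1) φ) : Fin (n₀ + 2) → MvPolynomial (Fin 2) ℂ) H) =
      coeff (Finsupp.single 0 i + Finsupp.single 1 j) H := by
  have h2le : 2 ≤ n₀ + 2 := Nat.le_add_left 2 n₀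
  set ρ : MvPolynomial (Fin (n₀ + 2)) ℂ →ₐ[ℂ] MvPolynomial (Fin 2) ℂ :=
    MvPolynomial.killCompl (Fin.castLE_injective h2le) with hρ_def
  have hρcoeff : ∀ (e : Fin 2 →₀ ℕ) (H : MvPolynomial (Fin (n₀ + 2)) ℂ),
      coeff e (ρ H) = coeff (e.mapDomain (Fin.castLE h2le)) H := fun e H =>
    MvPolynomial.coeff_killCompl _
  have hρX : ∀ k : Fin 2, ρ (X (Fin.castLE h2le k)) = X k := fun k => by
    simpa only [rename_X] using
      MvPolynomial.killCompl_rename_app (Fin.castLE_injective h2le) (X k : MvPolynomial (Fin 2) ℂ)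
  have hρXreg : ∀ j' : Fin n₀, ρ (X j'.succ.succ) = 0 := by
    intro j'
    simp only [hρ_def, MvPolynomial.killCompl, aeval_X]
    rw [dif_neg]
    rintro ⟨k, hk⟩
    have h' := congrArg Fin.val hk
    simp only [Fin.val_castLE, Fin.val_succ] at h'
    omega
  have hcast0 : Fin.castLE h2le (0 : Fin 2) = (0 : Fin (n₀ + 2)) := rfl
  have hcast1 : Fin.castLE h2le (1 : Fin 2) = (1 : Fin (n₀ + 2)) := rfl
  -- the restriction to the plane `φ = 0` is `ρ`
  have hρH : aeval (fun l => ρ (X l)) H = ρ H := by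
    rw [← MvPolynomial.comp_aeval, aeval_X_left]; rfl
  have hg : ∀ l, ∀ d : Fin 2 →₀ ℕ, d.degree < 1 →
      coeff d ((Fin.cons (X 0) (Fin.cons (X 1) φ) : Fin (n₀ + 2) → MvPolynomial (Fin 2) ℂ) l) = 0 :=
    fun l => Fin.cases (JetReduction.degGE_X 0) (fun l' => Fin.cases (JetReduction.degGE_X 1)
      (fun j' d hd => hφ j' d (by omega)) l') l
  have hg' : ∀ l, ∀ d : Fin 2 →₀ ℕ, d.degree < 1 → coeff d (ρ (X l)) = 0 := by
    intro l d hd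
    have hd0 : d = 0 := (Finsupp.degree_eq_zero_iff d).mp (by omega)
    rw [hρcoeff, hd0, Finsupp.mapDomain_zero]
    exact JetReduction.degGE_X l 0 (by simp)
  have hgg' : ∀ l, ∀ d : Fin 2 →₀ ℕ, d.degree < 1 + 1 →
      coeff d ((Fin.cons (X 0) (Fin.cons (X 1) φ) : Fin (n₀ + 2) → MvPolynomial (Fin 2) ℂ) l -
        ρ (X l)) = 0 := by
    intro l
    refine Fin.cases ?_ (fun l' => Fin.cases ?_ (fun j' d hd => ?_) l') l
    · intro d _; rw [Fin.cons_zero, ← hcast0, hρX, sub_self, coeff_zero]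
    · intro d _
      rw [Fin.cons_succ, Fin.cons_zero, Fin.succ_zero_eq_one, ← hcast1, hρX, sub_self, coeff_zero]
    · rw [Fin.cons_succ, Fin.cons_succ, hρXreg, sub_zero]; exact hφ j' d (by omega)
  have hdiff := JetReduction.aeval_sub_aeval_degGE hH hg hg' hgg'
    (Finsupp.single 0 i + Finsupp.single 1 j) (by
      simp only [map_add, Finsupp.degree_single]; omega)
  rw [coeff_sub, sub_eq_zero] at hdiff
  rw [hdiff, hρH, hρcoeff, Finsupp.mapDomain_add, Finsupp.mapDomain_single,
    Finsupp.mapDomain_single, hcast0, hcast1]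

/-! ## Two small transport lemmas for the two-level elimination -/

/-- The `X₁`-axis coefficients of `R ∈ ℂ⟦W, X₁⟧` are the constant coefficients of the
`X₁^j`-coefficients of `optionEquivLeft R`. -/
theorem constantCoeff_coeff_optionEquivLeft {τ : Type*} (R : MvPowerSeries (Option τ) ℂ) (j : ℕ) :
    MvPowerSeries.constantCoeff (PowerSeries.coeff j
      (Literature.RingTheory.MvPowerSeries.optionEquivLeft R)) =
      MvPowerSeries.coeff (Finsupp.single none j) R := by
  rw [← MvPowerSeries.coeff_zero_eq_constantCoeff_apply,
    Literature.RingTheory.MvPowerSeries.coeff_coeff_optionEquivLeft, Finsupp.optionElim_zero]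

/-- The embedding `ℂ[W, X₁][X₂] → ℂ⟦W, X₁⟧⟦X₂⟧` is additive and maps `C (X s)` to `C (X s)`. -/
theorem coe_add_C_X {τ : Type*} (F : Polynomial (MvPolynomial τ ℂ)) (s : τ) :
    (((F + Polynomial.C (X s)).map MvPolynomial.coeToMvPowerSeries.ringHom :
        Polynomial (MvPowerSeries τ ℂ)) : PowerSeries (MvPowerSeries τ ℂ)) =
      ((F.map MvPolynomial.coeToMvPowerSeries.ringHom : Polynomial (MvPowerSeries τ ℂ)) :
        PowerSeries (MvPowerSeries τ ℂ)) + PowerSeries.C (MvPowerSeries.X s) := by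
  rw [Polynomial.map_add, Polynomial.map_C, Polynomial.coe_add, Polynomial.coe_C,
    MvPolynomial.coeToMvPowerSeries.ringHom_apply, MvPolynomial.coe_X]


end NondegenerateCorankTwo

end Summit.ValiantsHypothesis.ValiantsHypothesis.Theorems.BinomialCandidateStubs

end
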